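import Summits.CriticalPhenomena.CardyFormulaZ2.Theorems.CardyComplexConeDefs
import Summits.CriticalPhenomena.CardyFormulaZ2.Theorems.CardyComplexConeCoherentMoreraPairingBound

/-!
# Stub `stub_modeSelection` of line `finitary-green-pairing`
(crux `CoherentMorera`, stmt-CriticalPhenomena-11388)

**Mode selection.** Two coherence vectors `u` and `w = u ∘ classShift` (with `u(o⋆) ≠ 0` at some
corner class `o⋆`) for the corner observable `E = cornerObs Λ δ` force, for every guarded family and
every test function, `δ^{5/3} P₀ → 0` or `δ^{5/3} P₂ → 0`. Pure algebra, filters and a lattice-point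
count; no percolation input. The coherence defect of `u` at the corners `(v, f)`, `(v, f')` is
`u(f' − v) E(v, f) − u(f − v) E(v, f')`, of norm `≤ ε δ^{1/3}` eventually, on `K = tsupport φ`.
* Case A (`Σu = 0`, `Σu` the sum of `u` over the four classes): `u(o⋆) A₀(v)` is the sum of the four
  defects against the corner `(v, v + o⋆)` plus `E(v, v + o⋆) Σu`, so `‖A₀(v)‖ ≤ 4εδ^{1/3}/‖u(o⋆)‖`.
* Case C (a minor `d = u(o⋆) w(o) − u(o) w(o⋆) ≠ 0`): a `2 × 2` elimination (`elim_bound`) writes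
  `E_p d` as a combination of three defects, so `‖A₀(v)‖ ≤ 12 S ε δ^{1/3}/‖d‖` (`S = Σ ‖u‖`).
* Case B (otherwise): summing the vanishing minors over the cycle, which `classShift` permutes,
  gives `Σu (u(o⋆) − w(o⋆)) = 0`, so `w = u` on the classes: `u ≡ c ≠ 0` there, the defects read
  `c (E(v, f) − E(v, f'))` and `‖A₂(v)‖ ≤ 2 ε δ^{1/3}/‖c‖.
* Counting (`scaledNull_of_small`): `∂̄φ`, `∂φ` are bounded and vanish off `K ⊆ closedBall 0 R`; the
  sites `v` with `δv ∈ K` lie in a box of `≤ (2R+5)²/δ²` sites, so `‖δ^{5/3} P(δ)‖ ≤ (2R+5)² C B ε`.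
-/

namespace Summit.CriticalPhenomena.CardyFormulaZ2.Cruxes.CoherentMorera.FinitaryGreenPairing

open MeasureTheory Filter Set Metric Complex
open scoped Topology BigOperators
open Literature.Probability.LatticeModels
open Literature.Probability.RandomPlanarGeometry (DobrushinDomain)

noncomputable section

namespace ModeSelection

/-- The four corner classes. -/
theorem isCorner_zero_classes :
    IsCorner 0 (0 : Site 2) ∧ IsCorner 0 (-e0) ∧ IsCorner 0 (-e0 - e1) ∧ IsCorner 0 (-e1) := by
  refine ⟨isCorner_self 0, ?_, ?_, ?_⟩ <;> intro i <;> fin_cases i <;> simp [e0, e1]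

/-- A class is one of the four offsets (each coordinate is `0` or `−1`). -/
theorem eq_of_isCorner_zero {o : Site 2} (h : IsCorner 0 o) :
    o = 0 ∨ o = -e0 ∨ o = -e0 - e1 ∨ o = -e1 := by
  obtain ⟨h0, h1⟩ : _ ∧ _ := ⟨h 0, h 1⟩
  simp only [Pi.zero_apply] at h0 h1
  rcases h0 with h0 | h0 <;> rcases h1 with h1 | h1
  · left; ext i; fin_cases i <;> simp <;> omega
  · right; right; right; ext i; fin_cases i <;> simp [e1] <;> omega
  · right; left; ext i; fin_cases i <;> simp [e0] <;> omega
  · right; right; left; ext i; fin_cases i <;> simp [e0, e1] <;> omega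

/-- The shift cycle, step 1: `0 ↦ −e₀`. -/
@[simp] theorem classShift_zero : classShift 0 = -e0 := by
  ext i; fin_cases i <;> simp [classShift, e0]

/-- Step 2: `−e₀ ↦ −e₀−e₁`. -/
@[simp] theorem classShift_neg_e0 : classShift (-e0) = -e0 - e1 := by
  ext i; fin_cases i <;> simp [classShift, e0, e1]

/-- Step 3: `−e₀−e₁ ↦ −e₁`. -/
@[simp] theorem classShift_neg_e0_sub_e1 : classShift (-e0 - e1) = -e1 := by
  ext i; fin_cases i <;> simp [classShift, e0, e1]

/-- Step 4: `−e₁ ↦ 0`. -/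
@[simp] theorem classShift_neg_e1 : classShift (-e1) = 0 := by
  ext i; fin_cases i <;> simp [classShift, e0, e1]

/-- `classShift` permutes the four classes. -/
theorem isCorner_zero_classShift {o : Site 2} (h : IsCorner 0 o) : IsCorner 0 (classShift o) := by
  obtain ⟨h0, h1, h2, h3⟩ := isCorner_zero_classes
  rcases eq_of_isCorner_zero h with rfl | rfl | rfl | rfl <;> simpa

/-- A class offset gives a corner at every site: `IsCorner v (v + o)`. -/
theorem isCorner_add {v o : Site 2} (h : IsCorner 0 o) : IsCorner v (v + o) := by
  intro i
  have := h i
  simp only [Pi.add_apply, Pi.zero_apply] at this ⊢; omega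

/-- The four corners at a site `v`, indexed as in `A0`/`A2`. -/
theorem isCorner_site (v : Site 2) :
    IsCorner v v ∧ IsCorner v (v - e0) ∧ IsCorner v (v - e0 - e1) ∧ IsCorner v (v - e1) := by
  obtain ⟨-, h1, h2, h3⟩ := isCorner_zero_classes
  refine ⟨isCorner_self v, ?_, ?_, ?_⟩
  · simpa [sub_eq_add_neg] using isCorner_add (v := v) h1
  · simpa [sub_eq_add_neg, add_assoc] using isCorner_add (v := v) h2
  · simpa [sub_eq_add_neg] using isCorner_add (v := v) h3

/-- The norm of `u` at a class is at most the sum `S` of the four class norms. -/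
theorem norm_le_sum_of_isCorner (u : Site 2 → ℂ) {o : Site 2} (h : IsCorner 0 o) :
    ‖u o‖ ≤ ‖u 0‖ + ‖u (-e0)‖ + ‖u (-e0 - e1)‖ + ‖u (-e1)‖ := by
  rcases eq_of_isCorner_zero h with rfl | rfl | rfl | rfl <;>
    linarith [norm_nonneg (u 0), norm_nonneg (u (-e0)), norm_nonneg (u (-e0 - e1)),
      norm_nonneg (u (-e1))]

/-- For `φ ∈ C_c^∞`, `∂̄φ` and `∂φ` are bounded (the differential is continuous of compact
support). -/
theorem exists_bound_dbar_del {φ : ℂ → ℂ} (hφ : ContDiff ℝ (⊤ : ℕ∞) φ)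
    (hc : HasCompactSupport φ) :
    ∃ B : ℝ, 0 ≤ B ∧ (∀ p, ‖dbar φ p‖ ≤ B) ∧ (∀ p, ‖del φ p‖ ≤ B) := by
  have h1 : ContDiff ℝ 1 φ := contDiff_infty.mp hφ 1
  obtain ⟨C, hC⟩ := (h1.continuous_fderiv one_ne_zero).bounded_above_of_compact_support
    (hc.fderiv ℝ)
  have hu : ∀ p w : ℂ, ‖w‖ = 1 → ‖fderiv ℝ φ p w‖ ≤ C := fun p w hw => by
    simpa [hw] using (fderiv ℝ φ p).le_of_opNorm_le (hC p) w
  have hI : ∀ p : ℂ, ‖I * fderiv ℝ φ p I‖ ≤ C := fun p => by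
    rw [norm_mul, norm_I, one_mul]; exact hu p I norm_I
  refine ⟨C, (norm_nonneg _).trans (hC 0), fun p => ?_, fun p => ?_⟩ <;>
  · simp only [dbar, del, norm_div, Complex.norm_two]
    linarith [hu p 1 norm_one, hI p, norm_add_le (fderiv ℝ φ p 1) (I * fderiv ℝ φ p I),
      norm_sub_le (fderiv ℝ φ p 1) (I * fderiv ℝ φ p I)]

/-- Sites whose mesh point has norm `≤ R` lie in the box of half-width `⌈(R+1)/δ⌉₊` (adapted from
`SiteRegrouping.mem_box_of_near`). -/
theorem mem_box_of_norm_le {δ R : ℝ} (hδ : 0 < δ) {v : Site 2} (hv : ‖meshPoint δ v‖ ≤ R) :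
    v ∈ ((Finset.Icc (-(⌈(R + 1) / δ⌉₊ : ℤ)) ⌈(R + 1) / δ⌉₊) ×ˢ
      (Finset.Icc (-(⌈(R + 1) / δ⌉₊ : ℤ)) ⌈(R + 1) / δ⌉₊)).image
      (fun q : ℤ × ℤ => (![q.1, q.2] : Site 2)) := by
  have h1 : ‖meshPoint δ v‖ ≤ R + 1 := by linarith
  have hcoord : ∀ c : ℤ, |δ * c| ≤ R + 1 → |c| ≤ ((⌈(R + 1) / δ⌉₊ : ℕ) : ℤ) := by
    intro c hcδ
    rw [abs_mul, abs_of_pos hδ] at hcδ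
    have : (|c| : ℝ) ≤ (⌈(R + 1) / δ⌉₊ : ℕ) := by
      refine le_trans ?_ (Nat.le_ceil _)
      rw [le_div_iff₀ hδ, mul_comm]
      exact hcδ
    exact_mod_cast this
  apply mem_box
  · exact hcoord _ (le_trans (by rw [← meshPoint_re]; exact abs_re_le_norm _) h1)
  · exact hcoord _ (le_trans (by rw [← meshPoint_im]; exact abs_im_le_norm _) h1)

/-- The box of half-width `⌈(R+1)/δ⌉₊` has at most `(2R+5)²/δ²` sites, for `0 < δ ≤ 1`. -/
theorem card_box_mul_sq_le {R δ : ℝ} (hR : 0 < R) (hδ : 0 < δ) (hδ1 : δ ≤ 1) :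
    ((((Finset.Icc (-(⌈(R + 1) / δ⌉₊ : ℤ)) ⌈(R + 1) / δ⌉₊) ×ˢ
      (Finset.Icc (-(⌈(R + 1) / δ⌉₊ : ℤ)) ⌈(R + 1) / δ⌉₊)).image
      (fun q : ℤ × ℤ => (![q.1, q.2] : Site 2))).card : ℝ) * δ ^ 2 ≤ (2 * R + 5) ^ 2 := by
  set N : ℕ := ⌈(R + 1) / δ⌉₊ with hN
  have hNlt : (N : ℝ) < (R + 1) / δ + 1 := Nat.ceil_lt_add_one (by positivity)
  have h1 : ((((Finset.Icc (-(N : ℤ)) N) ×ˢ (Finset.Icc (-(N : ℤ)) N)).image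
      (fun q : ℤ × ℤ => (![q.1, q.2] : Site 2))).card : ℝ) ≤ (2 * N + 1) ^ 2 := by
    exact_mod_cast card_box_le N
  have h2 : (N : ℝ) * δ < R + 1 + δ := by
    have := mul_lt_mul_of_pos_right hNlt hδ
    rwa [add_mul, div_mul_cancel₀ _ hδ.ne', one_mul] at this
  have h3 : (2 * (N : ℝ) + 1) * δ ≤ 2 * R + 5 := by nlinarith
  have h4 : 0 ≤ (2 * (N : ℝ) + 1) * δ := by positivity
  calc _ ≤ (2 * (N : ℝ) + 1) ^ 2 * δ ^ 2 := by gcongr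
    _ = ((2 * (N : ℝ) + 1) * δ) ^ 2 := by ring
    _ ≤ (2 * R + 5) ^ 2 := by gcongr

/-- **Counting.** Let `ψ` be bounded by `B` and vanish off the bounded set `K`, and let the site
functions `a δ` satisfy `‖a δ v‖ ≤ C ε δ^{1/3}` at the sites `v` with `δv ∈ K`, eventually as
`δ → 0⁺`, for every `ε > 0`. Then `δ^{5/3} Σ_v a δ v · ψ(δv) → 0`: the sum has at most
`(2R+5)²/δ²` non-zero terms (`K ⊆ closedBall 0 R`, `0 < δ ≤ 1`), so its scaled norm is at most
`(2R+5)² C B ε` since `δ^{5/3} · δ^{1/3} = δ²`. -/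
theorem scaledNull_of_small {K : Set ℂ} (hK : Bornology.IsBounded K) {ψ : ℂ → ℂ} {B C : ℝ}
    (hB : 0 ≤ B) (hC : 0 ≤ C) (hψ0 : ∀ p, p ∉ K → ψ p = 0) (hψb : ∀ p, ‖ψ p‖ ≤ B)
    {a : ℝ → Site 2 → ℂ}
    (ha : ∀ ε > (0:ℝ), ∀ᶠ δ in 𝓝[>] (0:ℝ), ∀ v : Site 2, meshPoint δ v ∈ K →
      ‖a δ v‖ ≤ C * ε * δ ^ ((1:ℝ) / 3)) :
    ScaledNull (fun δ => ∑ᶠ v : Site 2, a δ v * ψ (meshPoint δ v)) := by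
  classical
  obtain ⟨R, hRpos, hR⟩ := hK.exists_pos_norm_le
  rw [ScaledNull, NormedAddGroup.tendsto_nhds_zero]
  intro ε' hε'
  set M : ℝ := (2 * R + 5) ^ 2 * C * B with hM
  have hM0 : 0 ≤ M := by positivity
  have hεM : M * (ε' / (M + 1)) < ε' := by
    rw [mul_div_assoc', div_lt_iff₀ (by positivity)]
    nlinarith
  filter_upwards [ha (ε' / (M + 1)) (by positivity), Ioc_mem_nhdsGT one_pos] with δ hδa hδI
  obtain ⟨hδ, hδ1⟩ := hδI
  set Box : Finset (Site 2) := ((Finset.Icc (-(⌈(R + 1) / δ⌉₊ : ℤ)) ⌈(R + 1) / δ⌉₊) ×ˢ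
      (Finset.Icc (-(⌈(R + 1) / δ⌉₊ : ℤ)) ⌈(R + 1) / δ⌉₊)).image
      (fun q : ℤ × ℤ => (![q.1, q.2] : Site 2)) with hBox
  have hcard : (Box.card : ℝ) * δ ^ 2 ≤ (2 * R + 5) ^ 2 := card_box_mul_sq_le hRpos hδ hδ1
  have hsupp : Function.support (fun v => a δ v * ψ (meshPoint δ v)) ⊆ ↑Box := by
    intro v hv
    refine mem_box_of_norm_le hδ (hR _ (not_not.1 fun hn => hv ?_))
    simp only [hψ0 _ hn, mul_zero]
  set t : ℝ := C * (ε' / (M + 1)) * δ ^ ((1:ℝ) / 3) with ht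
  have ht0 : 0 ≤ t := by positivity
  have hterm : ∀ v ∈ Box, ‖a δ v * ψ (meshPoint δ v)‖ ≤ t * B := by
    intro v _
    by_cases hv : meshPoint δ v ∈ K
    · rw [norm_mul]
      exact mul_le_mul (hδa v hv) (hψb _) (norm_nonneg _) ht0
    · rw [hψ0 _ hv, mul_zero, norm_zero]; positivity
  rw [finsum_eq_sum_of_support_subset _ hsupp, norm_mul, Complex.norm_real, Real.norm_eq_abs,
    abs_of_nonneg (Real.rpow_nonneg hδ.le _)]
  have hpow : δ ^ ((5:ℝ) / 3) * δ ^ ((1:ℝ) / 3) = δ ^ 2 := by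
    rw [← Real.rpow_add hδ, ← Real.rpow_two]; norm_num
  calc δ ^ ((5:ℝ) / 3) * ‖∑ v ∈ Box, a δ v * ψ (meshPoint δ v)‖
      ≤ δ ^ ((5:ℝ) / 3) * (Box.card * (t * B)) := by
        refine mul_le_mul_of_nonneg_left ?_ (Real.rpow_nonneg hδ.le _)
        calc _ ≤ ∑ v ∈ Box, t * B := norm_sum_le_of_le _ hterm
          _ = _ := by rw [Finset.sum_const, nsmul_eq_mul]
    _ = (Box.card * (δ ^ ((5:ℝ) / 3) * δ ^ ((1:ℝ) / 3))) * (C * B) * (ε' / (M + 1)) := by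
        rw [ht]; ring
    _ ≤ (2 * R + 5) ^ 2 * (C * B) * (ε' / (M + 1)) := by rw [hpow]; gcongr
    _ = M * (ε' / (M + 1)) := by rw [hM]; ring
    _ < ε' := hεM

section Pointwise

variable {E : Site 2 × Site 2 → ℂ} {u : Site 2 → ℂ} {v : Site 2} {t : ℝ}

/-- **Case A.** If `Σu = 0` then `u(o⋆) · A₀(v)` is the sum of the four coherence defects of `u`
against the corner `(v, v + o⋆)`, so `‖u(o⋆)‖ · ‖A₀(v)‖ ≤ 4t`. -/
theorem caseA {os : Site 2} (hos : IsCorner 0 os)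
    (hsum : u 0 + u (-e0) + u (-e0 - e1) + u (-e1) = 0)
    (hU : ∀ f f', IsCorner v f → IsCorner v f' →
      ‖u (f' - v) * E (v, f) - u (f - v) * E (v, f')‖ ≤ t) :
    ‖u os‖ * ‖A0 E v‖ ≤ 4 * t := by
  obtain ⟨c0, c1, c2, c3⟩ := isCorner_site v
  have cs := isCorner_add (v := v) hos
  obtain ⟨h0, h1, h2, h3⟩ : _ ∧ _ ∧ _ ∧ _ :=
    ⟨hU _ _ c0 cs, hU _ _ c1 cs, hU _ _ c2 cs, hU _ _ c3 cs⟩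
  rw [add_sub_cancel_left, sub_self] at h0
  rw [add_sub_cancel_left, sub_sub_cancel_left] at h1 h3
  rw [add_sub_cancel_left, show v - e0 - e1 - v = -e0 - e1 by abel] at h2
  have key : u os * A0 E v = (u os * E (v, v) - u 0 * E (v, v + os))
      + (u os * E (v, v - e0) - u (-e0) * E (v, v + os))
      + (u os * E (v, v - e0 - e1) - u (-e0 - e1) * E (v, v + os))
      + (u os * E (v, v - e1) - u (-e1) * E (v, v + os)) := by
    simp only [A0]
    linear_combination E (v, v + os) * hsum
  rw [← norm_mul, key]
  calc _ ≤ t + t + t + t :=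
        norm_add_le_of_le (norm_add_le_of_le (norm_add_le_of_le h0 h1) h2) h3
    _ = 4 * t := by ring

/-- **Case B.** If `u` is constant on the four classes then the defects of `u` read
`u(0) · (E(v, f) − E(v, f'))`, so `‖u(0)‖ · ‖A₂(v)‖ ≤ 2t`. -/
theorem caseB (h1 : u (-e0) = u 0) (h2 : u (-e0 - e1) = u 0) (h3 : u (-e1) = u 0)
    (hU : ∀ f f', IsCorner v f → IsCorner v f' →
      ‖u (f' - v) * E (v, f) - u (f - v) * E (v, f')‖ ≤ t) :
    ‖u 0‖ * ‖A2 E v‖ ≤ 2 * t := by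
  obtain ⟨c0, c1, c2, c3⟩ := isCorner_site v
  have hA := hU _ _ c0 c1
  have hB := hU _ _ c2 c3
  rw [sub_sub_cancel_left, sub_self, h1] at hA
  rw [sub_sub_cancel_left, show v - e0 - e1 - v = -e0 - e1 by abel, h3, h2] at hB
  have key : u 0 * A2 E v = (u 0 * E (v, v) - u 0 * E (v, v - e0))
      + (u 0 * E (v, v - e0 - e1) - u 0 * E (v, v - e1)) := by
    simp only [A2]; ring
  rw [← norm_mul, key]
  calc _ ≤ t + t := norm_add_le_of_le hA hB
    _ = 2 * t := by ring

/-- **Case C, one corner.** With `w = u ∘ classShift`, every corner value times the minor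
`d = u(o') w(o) − u(o) w(o')` is a combination of three coherence defects, one of `u`, two of `w`,
`E_p d = w_p (u_{o'} E_o − u_o E_{o'}) + u_{o'} (w_o E_p − w_p E_o) − u_o (w_{o'} E_p − w_p E_{o'})`
(then take norms). -/
theorem elim_bound {o o' f : Site 2} (ho : IsCorner 0 o) (ho' : IsCorner 0 o') (hf : IsCorner v f)
    (hU : ∀ f f', IsCorner v f → IsCorner v f' →
      ‖u (f' - v) * E (v, f) - u (f - v) * E (v, f')‖ ≤ t)
    (hW : ∀ f f', IsCorner v f → IsCorner v f' →
      ‖u (classShift (f' - v)) * E (v, f) - u (classShift (f - v)) * E (v, f')‖ ≤ t) :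
    ‖E (v, f)‖ * ‖u o' * u (classShift o) - u o * u (classShift o')‖ ≤
      (‖u (classShift (f - v))‖ + ‖u o'‖ + ‖u o‖) * t := by
  obtain ⟨b1, b2, b3⟩ : _ ∧ _ ∧ _ := ⟨hU _ _ (isCorner_add ho) (isCorner_add ho'),
    hW _ _ hf (isCorner_add ho), hW _ _ hf (isCorner_add ho')⟩
  simp only [add_sub_cancel_left] at b1 b2 b3
  have key : E (v, f) * (u o' * u (classShift o) - u o * u (classShift o')) =
      u (classShift (f - v)) * (u o' * E (v, v + o) - u o * E (v, v + o'))
      + u o' * (u (classShift o) * E (v, f) - u (classShift (f - v)) * E (v, v + o))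
      - u o * (u (classShift o') * E (v, f) - u (classShift (f - v)) * E (v, v + o')) := by
    ring
  have nm : ∀ c x : ℂ, ‖x‖ ≤ t → ‖c * x‖ ≤ ‖c‖ * t := fun c x hx => by
    rw [norm_mul]; exact mul_le_mul_of_nonneg_left hx (norm_nonneg _)
  rw [← norm_mul, key]
  calc _ ≤ ‖u (classShift (f - v))‖ * t + ‖u o'‖ * t + ‖u o‖ * t :=
        norm_sub_le_of_le (norm_add_le_of_le (nm _ _ b1) (nm _ _ b2)) (nm _ _ b3)
    _ = _ := by ring

/-- **Case C.** If the minor `d = u(o⋆) w(o) − u(o) w(o⋆)` is available then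
`‖A₀(v)‖ · ‖d‖ ≤ 12 S t`, with `S` the sum of the four class norms of `u`. -/
theorem caseC {os o : Site 2} (hos : IsCorner 0 os) (ho : IsCorner 0 o) (ht : 0 ≤ t)
    (hU : ∀ f f', IsCorner v f → IsCorner v f' →
      ‖u (f' - v) * E (v, f) - u (f - v) * E (v, f')‖ ≤ t)
    (hW : ∀ f f', IsCorner v f → IsCorner v f' →
      ‖u (classShift (f' - v)) * E (v, f) - u (classShift (f - v)) * E (v, f')‖ ≤ t) :
    ‖A0 E v‖ * ‖u os * u (classShift o) - u o * u (classShift os)‖ ≤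
      12 * (‖u 0‖ + ‖u (-e0)‖ + ‖u (-e0 - e1)‖ + ‖u (-e1)‖) * t := by
  set S : ℝ := ‖u 0‖ + ‖u (-e0)‖ + ‖u (-e0 - e1)‖ + ‖u (-e1)‖ with hS
  set d : ℂ := u os * u (classShift o) - u o * u (classShift os) with hd
  obtain ⟨c0, c1, c2, c3⟩ := isCorner_site v
  have key : ∀ f, IsCorner v f → IsCorner 0 (f - v) → ‖E (v, f)‖ * ‖d‖ ≤ 3 * S * t := by
    intro f hf hfv
    refine (elim_bound ho hos hf hU hW).trans ?_
    have a1 : ‖u (classShift (f - v))‖ ≤ S :=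
      norm_le_sum_of_isCorner u (isCorner_zero_classShift hfv)
    have a2 : ‖u os‖ ≤ S := norm_le_sum_of_isCorner u hos
    have a3 : ‖u o‖ ≤ S := norm_le_sum_of_isCorner u ho
    calc _ ≤ (S + S + S) * t := by gcongr
      _ = 3 * S * t := by ring
  obtain ⟨k0, k1, k2, k3⟩ := isCorner_zero_classes
  have b0 := key v c0 (by rwa [sub_self])
  have b1 := key (v - e0) c1 (by rwa [sub_sub_cancel_left])
  have b2 := key (v - e0 - e1) c2 (by rwa [show v - e0 - e1 - v = -e0 - e1 by abel])
  have b3 := key (v - e1) c3 (by rwa [sub_sub_cancel_left])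
  have hA : ‖A0 E v‖ ≤ ‖E (v, v)‖ + ‖E (v, v - e0)‖ + ‖E (v, v - e0 - e1)‖ + ‖E (v, v - e1)‖ :=
    norm_add_le_of_le (norm_add_le_of_le (norm_add_le_of_le le_rfl le_rfl) le_rfl) le_rfl
  calc ‖A0 E v‖ * ‖d‖
      ≤ (‖E (v, v)‖ + ‖E (v, v - e0)‖ + ‖E (v, v - e0 - e1)‖ + ‖E (v, v - e1)‖) * ‖d‖ :=
        mul_le_mul_of_nonneg_right hA (norm_nonneg _)
    _ ≤ 3 * S * t + 3 * S * t + 3 * S * t + 3 * S * t := by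
        rw [add_mul, add_mul, add_mul]
        exact add_le_add (add_le_add (add_le_add b0 b1) b2) b3
    _ = 12 * S * t := by ring

end Pointwise

/-- **Case B, the algebra on `u`.** If `Σu ≠ 0`, `u(o⋆) ≠ 0` and all the minors
`u(o⋆) w(o) − u(o) w(o⋆)` vanish, then `u` is constant on the four classes: summing the minors
over the cycle (which `classShift` permutes) gives `Σu · (u(o⋆) − w(o⋆)) = 0`, so
`w(o⋆) = u(o⋆)`, and then `u(o⋆) (w(o) − u(o)) = 0` for every class `o`. -/
theorem const_of_minors {u : Site 2 → ℂ} {os : Site 2} (hus : u os ≠ 0)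
    (hA : u 0 + u (-e0) + u (-e0 - e1) + u (-e1) ≠ 0)
    (hC : ∀ o, IsCorner 0 o → u os * u (classShift o) - u o * u (classShift os) = 0) :
    u (-e0) = u 0 ∧ u (-e0 - e1) = u 0 ∧ u (-e1) = u 0 := by
  obtain ⟨c0, c1, c2, c3⟩ := isCorner_zero_classes
  obtain ⟨h0, h1, h2, h3⟩ : _ ∧ _ ∧ _ ∧ _ := ⟨hC _ c0, hC _ c1, hC _ c2, hC _ c3⟩
  simp only [classShift_zero, classShift_neg_e0, classShift_neg_e0_sub_e1, classShift_neg_e1]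
    at h0 h1 h2 h3
  have key : (u 0 + u (-e0) + u (-e0 - e1) + u (-e1)) * (u os - u (classShift os)) = 0 := by
    linear_combination h0 + h1 + h2 + h3
  have hW : u (classShift os) = u os :=
    (sub_eq_zero.1 ((mul_eq_zero.1 key).resolve_left hA)).symm
  rw [hW] at h0 h1 h3
  refine ⟨mul_left_cancel₀ hus ?_, mul_left_cancel₀ hus ?_, mul_left_cancel₀ hus ?_⟩
  · linear_combination h0
  · linear_combination h1 + h0
  · linear_combination -h3

end ModeSelection

open ModeSelection

/-- STUB `stub_modeSelection` — **mode selection**: two coherence vectors `u`, `u ∘ classShift`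
with `u ≠ 0` on a class make `δ^{5/3}P₀ → 0` or `δ^{5/3}P₂ → 0` for every guarded family and test
function. Case A (`Σu = 0`) and Case C (a non-zero minor `u(o⋆) w(o) − u(o) w(o⋆)`) bound the
spin-`1/3` site mode `A₀` by `C(u) ε δ^{1/3}` on `tsupport φ`; otherwise (Case B) `u` is a non-zero
constant on the classes and the staggered mode `A₂` is bounded by `2 ε δ^{1/3}/‖u 0‖`; the count
`scaledNull_of_small` concludes (`∂̄φ`, `∂φ` are bounded and vanish off `tsupport φ`). The two
coherence hypotheses are read over `cornerObs` on `K := tsupport φ` (definitional unfolding). -/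
theorem stub_modeSelection : Sig.stub_modeSelection := by
  rintro u ⟨os, hos, hus⟩ hu hw D Λ ⟨hΩ, hδ, hadm⟩ φ ⟨hφ, hc, hsub⟩
  have cohU := fun ε (hε : 0 < ε) => hu D Λ hΩ hδ hadm (tsupport φ) hc.isCompact hsub ε hε
  have cohW := fun ε (hε : 0 < ε) => hw D Λ hΩ hδ hadm (tsupport φ) hc.isCompact hsub ε hε
  obtain ⟨B, hB0, hBd, hBl⟩ := exists_bound_dbar_del hφ hc
  have hK : Bornology.IsBounded (tsupport φ) := hc.isCompact.isBounded
  have hd0 : ∀ p, p ∉ tsupport φ → dbar φ p = 0 := fun p hp => by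
    simp [dbar, fderiv_of_notMem_tsupport ℝ hp]
  have hl0 : ∀ p, p ∉ tsupport φ → del φ p = 0 := fun p hp => by
    simp [del, fderiv_of_notMem_tsupport ℝ hp]
  by_cases hA : u 0 + u (-e0) + u (-e0 - e1) + u (-e1) = 0
  · -- Case A: `‖u(o⋆)‖ ‖A₀(v)‖ ≤ 4 ε δ^{1/3}`
    left
    have hpos : 0 < ‖u os‖ := norm_pos_iff.2 hus
    refine scaledNull_of_small (a := fun δ v => A0 (cornerObs Λ δ) v) (ψ := dbar φ) hK hB0
      (C := 4 / ‖u os‖) (by positivity) hd0 hBd fun ε hε => ?_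
    filter_upwards [cohU ε hε] with δ hU v hv
    have h := caseA (E := cornerObs Λ δ) hos hA fun f f' hf hf' => hU v f f' hf hf' hv
    rw [div_mul_eq_mul_div, div_mul_eq_mul_div, le_div_iff₀ hpos]
    linarith
  by_cases hCm : ∃ o, IsCorner 0 o ∧ u os * u (classShift o) - u o * u (classShift os) ≠ 0
  · -- Case C: `‖A₀(v)‖ ‖d‖ ≤ 12 S ε δ^{1/3}`
    obtain ⟨o, ho, hd⟩ := hCm
    left
    have hpos : 0 < ‖u os * u (classShift o) - u o * u (classShift os)‖ := norm_pos_iff.2 hd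
    refine scaledNull_of_small (a := fun δ v => A0 (cornerObs Λ δ) v) (ψ := dbar φ) hK hB0
      (C := 12 * (‖u 0‖ + ‖u (-e0)‖ + ‖u (-e0 - e1)‖ + ‖u (-e1)‖) /
        ‖u os * u (classShift o) - u o * u (classShift os)‖) (by positivity) hd0 hBd
      fun ε hε => ?_
    filter_upwards [cohU ε hε, cohW ε hε, self_mem_nhdsWithin] with δ hU hW hδ0 v hv
    have h := caseC (E := cornerObs Λ δ) hos ho
      (mul_nonneg hε.le (Real.rpow_nonneg (le_of_lt (α := ℝ) hδ0) _))
      (fun f f' hf hf' => hU v f f' hf hf' hv) (fun f f' hf hf' => hW v f f' hf hf' hv)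
    rw [div_mul_eq_mul_div, div_mul_eq_mul_div, le_div_iff₀ hpos]
    linarith
  · -- Case B: `u ≡ u 0 ≠ 0` on the classes, `‖u 0‖ ‖A₂(v)‖ ≤ 2 ε δ^{1/3}`
    push Not at hCm
    obtain ⟨h1, h2, h3⟩ := const_of_minors hus hA hCm
    have hu0 : u os = u 0 := by
      rcases eq_of_isCorner_zero hos with rfl | rfl | rfl | rfl <;> simp [h1, h2, h3]
    rw [hu0] at hus
    right
    have hpos : 0 < ‖u 0‖ := norm_pos_iff.2 hus
    refine scaledNull_of_small (a := fun δ v => A2 (cornerObs Λ δ) v) (ψ := del φ) hK hB0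
      (C := 2 / ‖u 0‖) (by positivity) hl0 hBl fun ε hε => ?_
    filter_upwards [cohU ε hε] with δ hU v hv
    have h := caseB (E := cornerObs Λ δ) h1 h2 h3 fun f f' hf hf' => hU v f f' hf hf' hv
    rw [div_mul_eq_mul_div, div_mul_eq_mul_div, le_div_iff₀ hpos]
    linarith

end

end Summit.CriticalPhenomena.CardyFormulaZ2.Cruxes.CoherentMorera.FinitaryGreenPairing
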